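import Mathlib
import HarnessLib
import Summits.Ventures.LatticeQCDFlow.Scoring.ChainMeanSquareErrorSharp
import Summits.Ventures.LatticeQCDFlow.Scoring.ChainConfidenceInterval

/-!
# The burn-in bias of a time average is EXACTLY `b(μ₀)/N + o(1/N)` with
# `b(μ₀) = Σ_{t≥0} (μ₀ κ^t f − π f)`, and `N · Var_{μ₀}(f̄_N) → σ²_f`, from any start

HONEST FRAMING: exact (Metropolis-corrected) sampling algorithms for lattice gauge theory;
figures of merit are autocorrelation/cost numbers at stated couplings and volumes; no
continuum-physics claim.

Venture `LatticeQCDFlow` (cell pub-lqcd), topic `Scoring`; FANOUT row 8 (`s0-cpn-nemc`, GEN-18).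
NEW WORK of the cell, not a published result; no definition is introduced.  Setting of
`Scoring/ChainMeanSquareErrorSharp.lean`: `κ` Markov with invariant probability `π`,
`κ(x, ·) ≥ ε π` (`ε > 0`), `|f| ≤ C` measurable, `f̄ = f − π f`, `P_{μ₀}` the chain's path law from
ANY initial law `μ₀`, `f̄_N = (1/N) Σ_{i<N} f(X_i)`.  `Scoring/ChainBurnIn.lean` bounded the bias
`|E_{μ₀} f̄_N − π f| ≤ 2 (C + |πf|)/(ε N)`; here the first-order term is identified exactly and the
variance (not only the mean-square error) is shown to be asymptotically `σ²_f / N`: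

* `abs_integral_iterate_kop_le_of_doeblin` — `|∫ κ^t f̄ dμ₀| ≤ (1 − ε/2)^t C_{f̄}`;
* `summable_integral_iterate_kop_of_doeblin` — the initial transient `t ↦ ∫ κ^t f̄ dμ₀` is summable;
* `chain_timeAverage_bias_eq` — `N (E_{μ₀} f̄_N − π f) = Σ_{t<N} ∫ κ^t f̄ dμ₀` exactly (`N ≥ 1`);
* **`chain_bias_mul_tendsto`** — `N (E_{μ₀} f̄_N − π f) → b(μ₀) := Σ_{t≥0} ∫ κ^t f̄ dμ₀`;
  (from the invariant law the bias is `0` for every `N ≥ 1`: the tree's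
  `Scoring/WarmStartTransfer.chain_mean_timeAverage`, not restated);
* **`chain_variance_tendsto_greenKubo`** — `N · Var_{P_{μ₀}}[f̄_N] → σ²_f` for EVERY initial law
  (`N · MSE → σ²_f` by `chain_mse_tendsto_greenKubo`, and `N · bias² → 0`).

Printed counterpart NAMED ONLY: Sokal 1996 lecture notes §2 ("initialization bias"), Madras–Sokal
1988 §2 — nothing is cited as a fact.

NOT CLAIMED: any `ε` of a concrete sampler; the sign or size of `b(μ₀)` for a concrete start;
unbounded `f`.
-/

noncomputable section

namespace Summit.Ventures.LatticeQCDFlow.Scoring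

open MeasureTheory ProbabilityTheory Filter Finset Preorder Literature.Probability.MarkovChains
open scoped ENNReal Topology

variable {Ω : Type*} [MeasurableSpace Ω]
variable {κ : Kernel Ω Ω} [IsMarkovKernel κ] {π : Measure Ω} [IsProbabilityMeasure π] {ε : ℝ≥0∞}

/-- `|∫ κ^t g dμ₀| ≤ (1 − ε/2)^t C` for a centred bounded `g` and any probability law `μ₀`. -/
theorem abs_integral_iterate_kop_le_of_doeblin (hπ : Kernel.Invariant κ π)
    (hmin : ∀ x {B : Set Ω}, MeasurableSet B → ε * π B ≤ κ x B) (hε0 : 0 < ε) {g : Ω → ℝ}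
    (hg : Measurable g) {C : ℝ} (hC : ∀ x, |g x| ≤ C) (hg0 : ∫ x, g x ∂π = 0)
    (μ₀ : Measure Ω) [IsProbabilityMeasure μ₀] (t : ℕ) :
    |∫ x, (kop κ)^[t] g x ∂μ₀| ≤ (1 - (ε / 2).toReal) ^ t * C := by
  calc |∫ x, (kop κ)^[t] g x ∂μ₀| ≤ ∫ x, |(kop κ)^[t] g x| ∂μ₀ := abs_integral_le_integral_abs
    _ ≤ ∫ _, (1 - (ε / 2).toReal) ^ t * C ∂μ₀ :=
        integral_mono_of_nonneg (ae_of_all _ fun x => abs_nonneg _) (integrable_const _)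
          (ae_of_all _ fun x => abs_iterate_kop_le_of_doeblin hπ hmin hε0 hg hC hg0 t x)
    _ = (1 - (ε / 2).toReal) ^ t * C := by
        rw [integral_const, smul_eq_mul, probReal_univ, one_mul]

/-- The initial transient `t ↦ ∫ κ^t g dμ₀` of a centred bounded observable is summable. -/
theorem summable_integral_iterate_kop_of_doeblin (hπ : Kernel.Invariant κ π)
    (hmin : ∀ x {B : Set Ω}, MeasurableSet B → ε * π B ≤ κ x B) (hε0 : 0 < ε) {g : Ω → ℝ}
    (hg : Measurable g) {C : ℝ} (hC : ∀ x, |g x| ≤ C) (hg0 : ∫ x, g x ∂π = 0)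
    (μ₀ : Measure Ω) [IsProbabilityMeasure μ₀] :
    Summable fun t : ℕ => ∫ x, (kop κ)^[t] g x ∂μ₀ := by
  obtain ⟨-, hr0, hr1, -, -, -⟩ := half_const_bounds hmin hε0
  refine Summable.of_norm_bounded ((summable_geometric_of_lt_one hr0 hr1).mul_right C) fun t => ?_
  rw [Real.norm_eq_abs]
  exact abs_integral_iterate_kop_le_of_doeblin hπ hmin hε0 hg hC hg0 μ₀ t

/-- **EXACT BIAS FORMULA**: `N (E_{μ₀} f̄_N − π f) = Σ_{t<N} ∫ κ^t (f − πf) dμ₀` for `N ≥ 1`. -/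
theorem chain_timeAverage_bias_eq {f : Ω → ℝ} (hf : Measurable f) {C : ℝ} (hC : ∀ x, |f x| ≤ C)
    (μ₀ : Measure Ω) [IsProbabilityMeasure μ₀] {N : ℕ} (hN : N ≠ 0) :
    (N : ℝ) * (∫ x, (∑ i ∈ Finset.range N, f (x i)) / N ∂(Kernel.trajMeasure (X := fun _ : ℕ => Ω) μ₀
          (fun n : ℕ => κ.comap (fun h : (i : ↥(Finset.Iic n)) → Ω => h ⟨n, Finset.mem_Iic.2 le_rfl⟩)
            (measurable_pi_apply _))) - ∫ z, f z ∂π)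
      = ∑ t ∈ Finset.range N, ∫ x, (kop κ)^[t] (fun y => f y - ∫ z, f z ∂π) x ∂μ₀ := by
  set c := ∫ z, f z ∂π with hc
  obtain ⟨hg, hCg, -⟩ := centred_observable_bounds π hf hC
  have hN' : (N : ℝ) ≠ 0 := Nat.cast_ne_zero.2 hN
  have hint : ∀ i : ℕ, Integrable (fun x : ℕ → Ω => f (x i))
      (Kernel.trajMeasure (X := fun _ : ℕ => Ω) μ₀
        (fun n : ℕ => κ.comap (fun h : (i : ↥(Finset.Iic n)) → Ω => h ⟨n, Finset.mem_Iic.2 le_rfl⟩)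
          (measurable_pi_apply _))) := fun i =>
    Integrable.mono' (integrable_const C) (hf.comp (measurable_pi_apply i)).aestronglyMeasurable
      (ae_of_all _ fun x => by rw [Real.norm_eq_abs]; exact hC (x i))
  have hti : ∀ i : ℕ, ∫ x, f (x i) ∂(Kernel.trajMeasure (X := fun _ : ℕ => Ω) μ₀
        (fun n : ℕ => κ.comap (fun h : (i : ↥(Finset.Iic n)) → Ω => h ⟨n, Finset.mem_Iic.2 le_rfl⟩)
          (measurable_pi_apply _))) - c = ∫ x, (kop κ)^[i] (fun y => f y - c) x ∂μ₀ := fun i => by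
    rw [← chain_expect κ μ₀ hg hCg i, integral_sub (hint i) (integrable_const c), integral_const,
      smul_eq_mul, probReal_univ, one_mul]
  rw [integral_div, integral_finsetSum _ (fun i _ => hint i), mul_sub, mul_div_cancel₀ _ hN',
    show (N : ℝ) * c = ∑ i ∈ Finset.range N, c by
      rw [Finset.sum_const, Finset.card_range, nsmul_eq_mul],
    ← Finset.sum_sub_distrib]
  exact Finset.sum_congr rfl fun i _ => hti i

/-- **THE BIAS IS `b(μ₀)/N` TO FIRST ORDER**: `N (E_{μ₀} f̄_N − π f) → Σ_{t≥0} ∫ κ^t (f − πf) dμ₀`. -/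
theorem chain_bias_mul_tendsto (hπ : Kernel.Invariant κ π)
    (hmin : ∀ x {B : Set Ω}, MeasurableSet B → ε * π B ≤ κ x B) (hε0 : 0 < ε)
    {f : Ω → ℝ} (hf : Measurable f) {C : ℝ} (hC : ∀ x, |f x| ≤ C)
    (μ₀ : Measure Ω) [IsProbabilityMeasure μ₀] :
    Tendsto (fun N : ℕ => (N : ℝ) * (∫ x, (∑ i ∈ Finset.range N, f (x i)) / N
        ∂(Kernel.trajMeasure (X := fun _ : ℕ => Ω) μ₀
          (fun n : ℕ => κ.comap (fun h : (i : ↥(Finset.Iic n)) → Ω => h ⟨n, Finset.mem_Iic.2 le_rfl⟩)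
            (measurable_pi_apply _))) - ∫ z, f z ∂π))
      atTop (𝓝 (∑' t, ∫ x, (kop κ)^[t] (fun y => f y - ∫ z, f z ∂π) x ∂μ₀)) := by
  obtain ⟨hg, hCg, hg0⟩ := centred_observable_bounds π hf hC
  have hsum := summable_integral_iterate_kop_of_doeblin hπ hmin hε0 hg hCg hg0 μ₀
  refine hsum.hasSum.tendsto_sum_nat.congr' ?_
  filter_upwards [Filter.eventually_ne_atTop 0] with N hN
  exact (chain_timeAverage_bias_eq hf hC μ₀ hN).symm

/-- **THE VARIANCE OF THE TIME AVERAGE IS ASYMPTOTICALLY `σ²_f / N`, FROM ANY START**: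
`N · Var_{P_{μ₀}}[f̄_N] → σ²_f = γ_0 + 2 Σ_{k≥1} γ_k`. -/
theorem chain_variance_tendsto_greenKubo (hπ : Kernel.Invariant κ π)
    (hmin : ∀ x {B : Set Ω}, MeasurableSet B → ε * π B ≤ κ x B) (hε0 : 0 < ε)
    {f : Ω → ℝ} (hf : Measurable f) {C : ℝ} (hC : ∀ x, |f x| ≤ C)
    (μ₀ : Measure Ω) [IsProbabilityMeasure μ₀] :
    Tendsto (fun N : ℕ => (N : ℝ) * Var[fun x : ℕ → Ω => (∑ i ∈ Finset.range N, f (x i)) / N;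
        Kernel.trajMeasure (X := fun _ : ℕ => Ω) μ₀
          (fun n : ℕ => κ.comap (fun h : (i : ↥(Finset.Iic n)) → Ω => h ⟨n, Finset.mem_Iic.2 le_rfl⟩)
            (measurable_pi_apply _))])
      atTop (𝓝 ((∫ y, (f y - ∫ z, f z ∂π) ^ 2 ∂π)
        + 2 * ∑' k, ∫ y, (f y - ∫ z, f z ∂π) * (kop κ)^[k + 1] (fun y => f y - ∫ z, f z ∂π) y ∂π)) := by
  set P := Kernel.trajMeasure (X := fun _ : ℕ => Ω) μ₀
          (fun n : ℕ => κ.comap (fun h : (i : ↥(Finset.Iic n)) → Ω => h ⟨n, Finset.mem_Iic.2 le_rfl⟩)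
            (measurable_pi_apply _)) with hP
  set c := ∫ z, f z ∂π with hc
  have hmse := chain_mse_tendsto_greenKubo hπ hmin hε0 hf hC μ₀
  have hb := chain_bias_mul_tendsto hπ hmin hε0 hf hC μ₀
  rw [← hP, ← hc] at hmse hb
  -- the bias itself tends to `0`
  have hb0 : Tendsto (fun N : ℕ => ∫ x, (∑ i ∈ Finset.range N, f (x i)) / N ∂P - c) atTop (𝓝 0) := by
    have h := hb.mul (tendsto_inv_atTop_nhds_zero_nat (𝕜 := ℝ))
    rw [mul_zero] at h
    refine h.congr' ?_
    filter_upwards [Filter.eventually_ne_atTop 0] with N hN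
    have hN' : (N : ℝ) ≠ 0 := Nat.cast_ne_zero.2 hN
    field_simp
  have hprod := hb.mul hb0
  rw [mul_zero] at hprod
  have hfin := hmse.sub hprod
  rw [sub_zero] at hfin
  refine hfin.congr' ?_
  filter_upwards [Filter.eventually_ne_atTop 0] with N hN
  -- `Var[A_N] = E[(A_N − c)²] − (E[A_N] − c)²`
  have hAm : Measurable fun x : ℕ → Ω => (∑ i ∈ Finset.range N, f (x i)) / N :=
    (Finset.measurable_sum _ fun i _ => hf.comp (measurable_pi_apply i)).div_const _
  have hLp : MemLp (fun x : ℕ → Ω => (∑ i ∈ Finset.range N, f (x i)) / N - c) 2 P :=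
    MemLp.of_bound (hAm.sub_const c).aestronglyMeasurable (C + |c|)
      (ae_of_all _ fun x => by rw [Real.norm_eq_abs]; exact abs_timeAverage_sub_le hC hN c x)
  have hint : Integrable (fun x : ℕ → Ω => (∑ i ∈ Finset.range N, f (x i)) / N) P :=
    Integrable.mono' (integrable_const (C + |(0 : ℝ)|)) hAm.aestronglyMeasurable
      (ae_of_all _ fun x => by
        rw [Real.norm_eq_abs]
        have h := abs_timeAverage_sub_le hC hN 0 x
        rwa [sub_zero] at h)
  have hvar : Var[fun x : ℕ → Ω => (∑ i ∈ Finset.range N, f (x i)) / N; P]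
      = (∫ x, ((∑ i ∈ Finset.range N, f (x i)) / N - c) ^ 2 ∂P)
        - (∫ x, (∑ i ∈ Finset.range N, f (x i)) / N ∂P - c) ^ 2 := by
    rw [← variance_sub_const hAm.aestronglyMeasurable c, variance_eq_sub hLp]
    simp only [Pi.pow_apply]
    rw [integral_sub hint (integrable_const c), integral_const, smul_eq_mul, probReal_univ, one_mul]
  rw [hvar]
  ring

end Summit.Ventures.LatticeQCDFlow.Scoring

end
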